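import Summits.BirchSwinnertonDyer.BirchSwinnertonDyer.Theorems.ByReductionTypeAtTwoSupersingularFlatBlindCardGlue
import Summits.BirchSwinnertonDyer.BirchSwinnertonDyer.Theorems.ByReductionTypeAtTwoSupersingularFlatBlindCardIndex
import Summits.BirchSwinnertonDyer.BirchSwinnertonDyer.Theorems.ByReductionTypeAtTwoSupersingularFlatBlindCardTransport
import Summits.BirchSwinnertonDyer.BirchSwinnertonDyer.Theorems.ByReductionTypeAtTwoSupersingularFlatBlindTwistCurveSide
import Summits.BirchSwinnertonDyer.BirchSwinnertonDyer.Theorems.ByReductionTypeAtTwoSupersingularFlatBlindTwistSideStrictCount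
import Summits.BirchSwinnertonDyer.BirchSwinnertonDyer.Theorems.ByReductionTypeAtTwoSupersingularFlatBlindTwistSideKummerLine
import Summits.BirchSwinnertonDyer.Rank1Residual.F1Sign2.HondaSystemAtTwo
import HarnessLib

/-!
# Route `ByReductionTypeAtTwo` (rung K4), crux `SupersingularRankZeroAtTwo` (item stmt-BirchSwinnertonDyer-19097), line
# `odd_blind_package` (registry v2.10.1), slot 5 `stub_CD` = CDC_H: **THE POSITION GLUE — binder (B3) of the CDC_H glue
# (`flatBlindControlCardHondaAtTwo_of`, ★★ p814705) from two NAMED binders: (B3loc) the LOCAL COMPLEMENT property of the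
# transported ♭-line at `v ∣ 2` and (B3glob) the generic POSITION COUNT FOR A COMPLEMENTARY LINE** (cell `bsd-2adic`, LEAD ss-1 GEN 21)

HONEST FRAMING. `position_of_complement_of_lineCount (hloc) (hglob) : <hB3 of the glue, verbatim>` is a REDUCTION, kernel-checked:
the position binder (B3) «`#H¹_{𝓑'_J}(ℚ, W₂[2^J]) = #S⁰(W₂) · 2^{v₂ λ(P₁ ⊗ ℚ₂)}` for `J ≥ J₂`, `𝓑'_J` = (ψ-transported ♭-line `L_J` at `v`,
Kummer elsewhere)» follows from
* (B3loc) LINE COMPLEMENT (local at `v ∣ 2`, line-specific, quantified over the same dictionary `(φ, ψ)` as (B3)): for `J ≥ J₃`,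
  `L_J ⊓ Kum_J(W₂)_v = ⊥` and `L_J ⊔ Kum_J(W₂)_v = ⊤` in `H¹(ℚ_v, W₂[2^J])` — the TRANSVERSALITY `t = 0` of the ♭-condition to the
  global point (the «blind» in `odd_blind_package`: `Sel♭[γ+1]` is finite although `rank W₂(ℚ) = 1`) and the LINE property `#L_J = 2^J`;
* (B3glob) POSITION COUNT FOR A COMPLEMENTARY LINE (generic: any `E/ℚ`, prime `p`, `v ∣ p`, with `E(ℚ_v)[p] = 0`, `E(ℚ)[p] = 0`,
  `rank E(ℚ) = 1`, `Ш[p^∞]` finite): for `J ≥ J₂` and ANY complement `L` of `Kum_J(E)_v`, the Selmer group of (L at `v`, Kummer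
  elsewhere) has order `#S⁰ · p^{v_p λ(P₁)}`, `S⁰ = Sel_{p^∞} ∩ ker res_p` (strict), `λ : E(ℚ_p) ↠ ℤ_p` killing exactly the torsion,
  `P₁` a generator modulo torsion. Mathematics: `Sel_𝓛 = ker(Ψ : Sel_{𝓡,J} → Kum_J ≅ ℤ/p^J)`, `Ψ = π_K ∘ res_v` (projection along
  `L`); `Sel_{𝓡,J} ≅ X[p^J]`, `X = Sel^{rel v}_{p^∞}` of corank 1 with `X/(P₁ ⊗ ℚ_p/ℤ_p)` finite of exponent `p^{m'}`
  (`#X[p^J] = p^J · #S⁰`, the Poitou–Tate count for strict ≤ relaxed — the print binder `hPT` may be prepended by the prover, as for B2);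
  `im Ψ ⊇ Ψ(κ_J(ℤP₁)) = p^e Kum_J` (`e = v_p λ(P₁)`) and `im Ψ ⊆ p^e Kum_J + Kum_J[p^{m'}] = p^e Kum_J` once `J ≥ e + m'`; so
  `#Sel_𝓛 = p^J #S⁰ / p^{J−e}`. No level-compatibility of `L` is needed.
The «no `2`-torsion» inputs of (B3glob) come from ★ p814209. Typed ≠ proved: (B3loc)/(B3glob) are hypotheses; nothing is booked; 19097 stays
OPEN; BSD is proved for no curve. bears_on: K4 (19097). References: [GreenbergLNM1716] §4; [MilneADT2006] I Thm. 4.10; [Sprung2012] Def. 7.9/7.11.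
-/

set_option autoImplicit false
set_option linter.dupNamespace false

noncomputable section

open scoped Classical NumberField AddSubgroup ContRepresentation

namespace Summit.BirchSwinnertonDyer.BirchSwinnertonDyer.Theorems

namespace OddBlindLocal

open NumberField IsDedekindDomain Field WeierstrassCurve Literature.NumberTheory.EllipticCurves
  Literature.NumberTheory.EllipticCurves.IwasawaDual Literature.NumberTheory.GaloisRepresentations
  Literature.NumberTheory.GaloisCohomology ZpExtension Literature.NumberTheory.EllipticCurves.Kobayashi2003
  Literature.NumberTheory.EllipticCurves.Sprung2017 Literature.NumberTheory.EllipticCurves.Sprung2012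
  Literature.NumberTheory.EllipticCurves.Rank1Residual Summit.BirchSwinnertonDyer.Rank1Residual.Additive
open Literature.NumberTheory.GaloisRepresentations.DiscreteGaloisModule (SelmerStructure)

/-- **Position glue**: binder (B3) of `flatBlindControlCardHondaAtTwo_of` (its hypothesis `hB3`, VERBATIM) from the local line
complement (B3loc) and the generic position count for a complementary line (B3glob). The proof instantiates (B3glob) at `E := W₂`,
`p := 2`, the line `L := L_J(ψ)`, feeding `W₂(ℚ_v)[2] = 0`, `W₂(ℚ₂)[2] = 0` (★ p814209) and `W₂(ℚ)[2] = 0` (base change is injective),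
and takes `J₂ := max J₂(glob) J₃(loc)`. [cite: GreenbergLNM1716, §4 pp. 122–124] [cite: MilneADT2006, I Thm. 4.10] -/
theorem position_of_complement_of_lineCount
    (hloc : ∀ (W : WeierstrassCurve ℚ) [W.IsElliptic] [W.IsGloballyMinimal], GoodSS W 2 →
      ∀ (κ : ZpExtension ℚ 2), κ.IsCyclotomic →
      ∀ (v : HeightOneSpectrum (𝓞 ℚ)), (2 : 𝓞 ℚ) ∈ v.asIdeal →
      ∀ (g : Field.absoluteGaloisGroup (v.adicCompletion ℚ)) (c : ℕ → localPoints W (v.adicCompletion ℚ)),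
        κ.IsTopGenerator (resGalOfEmb (closureEmb (K := ℚ) (v.adicCompletion ℚ)) g) →
        (∀ n, c n ∈ localLayerPointsOfEmb κ (closureEmb (K := ℚ) (v.adicCompletion ℚ)) W n) →
        (∀ n, 1 ≤ n → localTraceOfEmb κ (closureEmb (K := ℚ) (v.adicCompletion ℚ)) W n (n + 1)
          (c (n + 1)) = W.frobeniusTrace 2 • c n - c (n - 1)) →
        (∀ z₀ : localLayerPointsOfEmb κ (closureEmb (K := ℚ) (v.adicCompletion ℚ)) W 0 →+ ℤ_[2],
          evalOn W (localLayerPointsOfEmb κ (closureEmb (K := ℚ) (v.adicCompletion ℚ)) W 0) z₀ (c 0) = 0 → z₀ = 0) →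
        (∀ a : ℤ_[2],
          (∃ z₀ : localLayerPointsOfEmb κ (closureEmb (K := ℚ) (v.adicCompletion ℚ)) W 0 →+ ℤ_[2],
            evalOn W (localLayerPointsOfEmb κ (closureEmb (K := ℚ) (v.adicCompletion ℚ)) W 0) z₀ (c 0) = 2 * a) →
          ∃ y : localLayerPointsOfEmb κ (closureEmb (K := ℚ) (v.adicCompletion ℚ)) W 0 →+ ℤ_[2],
            evalOn W (localLayerPointsOfEmb κ (closureEmb (K := ℚ) (v.adicCompletion ℚ)) W 0) y (c 0) = a) →
        (∃ cneg : localPoints W (v.adicCompletion ℚ),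
          Summit.BirchSwinnertonDyer.Rank1Residual.F1Sign2.IsHondaSystemAtTwo κ (closureEmb (K := ℚ) (v.adicCompletion ℚ)) W
            (W.frobeniusTrace 2) g cneg c) →
      ∀ (W₂ : WeierstrassCurve ℚ) [W₂.IsElliptic] [W₂.IsGloballyMinimal],
        (∃ C : WeierstrassCurve.VariableChange ℚ, C • W.quadraticTwist 2 = W₂) →
      ∃ J₃ : ℕ, ∀ J : ℕ, J₃ ≤ J →
      ∀ (φ : (W₂.torsionGaloisModule ((2 ^ J : ℕ) : ℤ)).toContRepresentation →ⁱL
          (W.twistedTorsionGaloisModule 2 κ J (-1) OddBlindTwist.two_dvd_neg_one_sub_one).toContRepresentation)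
        (ψ : (W.twistedTorsionGaloisModule 2 κ J (-1) OddBlindTwist.two_dvd_neg_one_sub_one).toContRepresentation →ⁱL
          (W₂.torsionGaloisModule ((2 ^ J : ℕ) : ℤ)).toContRepresentation),
        (∀ a, ψ (φ a) = a) → (∀ b, φ (ψ b) = b) →
        (∀ w : InfinitePlace ℚ, ((W.twistedTorsionToLocalH1 2 κ J (-1) OddBlindTwist.two_dvd_neg_one_sub_one w.Completion).ker).map
            (galoisCohomology.map (ψ.restrictField w.Completion) 1) =
          W₂.kummerLocalConditionAt ((2 ^ J : ℕ) : ℤ) w.Completion) →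
        (∀ v' : HeightOneSpectrum (𝓞 ℚ), v' ≠ v →
          (W.twistedSharpFlatLocalFamily 2 κ J (-1) OddBlindTwist.two_dvd_neg_one_sub_one v
              (localTowerPointsOfEmb κ (closureEmb (K := ℚ) (v.adicCompletion ℚ)) W)
              (colemanKer κ (closureEmb (K := ℚ) (v.adicCompletion ℚ)) W (W.frobeniusTrace 2) g c .flat) v').map
            (galoisCohomology.map (ψ.restrictField (v'.adicCompletion ℚ)) 1) =
          ((resH1Hom (Literature.NumberTheory.EllipticCurves.subgroupIncl (localSubgroup κ.kerSubgroup (v'.adicCompletion ℚ)))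
              (AddMonoidHom.id (localPoints W₂ (v'.adicCompletion ℚ))) (fun _ _ ↦ rfl)).ker).comap
            (galoisCohomology.map (W₂.torsionPointsMapIntertwining ((2 ^ J : ℕ) : ℤ) (v'.adicCompletion ℚ)) 1)) →
        (W₂.kummerLocalConditionAt ((2 ^ J : ℕ) : ℤ) (v.adicCompletion ℚ)).map
            (galoisCohomology.map (φ.restrictField (v.adicCompletion ℚ)) 1) ≤
          W.twistedTorsionLocalKummer 2 κ J (-1) OddBlindTwist.two_dvd_neg_one_sub_one (v.adicCompletion ℚ)
            (localLayerPointsOfEmb κ (closureEmb (K := ℚ) (v.adicCompletion ℚ)) W 1 ⊓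
              (DistribSMul.toAddMonoidHom (localPoints W (v.adicCompletion ℚ)) g + AddMonoidHom.id _).ker) →
        (W.twistedSharpFlatLocalFamily 2 κ J (-1) OddBlindTwist.two_dvd_neg_one_sub_one v
            (localTowerPointsOfEmb κ (closureEmb (K := ℚ) (v.adicCompletion ℚ)) W)
            (colemanKer κ (closureEmb (K := ℚ) (v.adicCompletion ℚ)) W (W.frobeniusTrace 2) g c .flat) v).map
          (galoisCohomology.map (ψ.restrictField (v.adicCompletion ℚ)) 1) ⊓
          W₂.kummerLocalConditionAt ((2 ^ J : ℕ) : ℤ) (v.adicCompletion ℚ) = ⊥ ∧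
        (W.twistedSharpFlatLocalFamily 2 κ J (-1) OddBlindTwist.two_dvd_neg_one_sub_one v
            (localTowerPointsOfEmb κ (closureEmb (K := ℚ) (v.adicCompletion ℚ)) W)
            (colemanKer κ (closureEmb (K := ℚ) (v.adicCompletion ℚ)) W (W.frobeniusTrace 2) g c .flat) v).map
          (galoisCohomology.map (ψ.restrictField (v.adicCompletion ℚ)) 1) ⊔
          W₂.kummerLocalConditionAt ((2 ^ J : ℕ) : ℤ) (v.adicCompletion ℚ) = ⊤)
    (hglob : ∀ (E : WeierstrassCurve ℚ) [E.IsElliptic] (p : ℕ) [Fact p.Prime]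
      (v : HeightOneSpectrum (𝓞 ℚ)), ((p : ℕ) : 𝓞 ℚ) ∈ v.asIdeal →
      (∀ P : (E.baseChange (v.adicCompletion ℚ)).toAffine.Point, p • P = 0 → P = 0) →
      (∀ P : (E.baseChange ℚ_[p]).toAffine.Point, p • P = 0 → P = 0) →
      (∀ P : E.toAffine.Point, p • P = 0 → P = 0) →
      E.mordellWeilRank = 1 → Finite (AddCommGroup.primaryComponent E.sha p) →
      ∃ J₂ : ℕ, ∀ J : ℕ, J₂ ≤ J →
      ∀ (L : AddSubgroup (galoisCohomology ((E.torsionGaloisModule ((p ^ J : ℕ) : ℤ)).restrictField (v.adicCompletion ℚ)) 1)),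
        L ⊓ E.kummerLocalConditionAt ((p ^ J : ℕ) : ℤ) (v.adicCompletion ℚ) = ⊥ →
        L ⊔ E.kummerLocalConditionAt ((p ^ J : ℕ) : ℤ) (v.adicCompletion ℚ) = ⊤ →
      ∀ (𝓛 : SelmerStructure (E.torsionGaloisModule ((p ^ J : ℕ) : ℤ))),
        (∀ w : InfinitePlace ℚ, 𝓛 (Sum.inl w) = E.kummerLocalConditionAt ((p ^ J : ℕ) : ℤ) w.Completion) →
        𝓛 (Sum.inr v) = L →
        (∀ v' : HeightOneSpectrum (𝓞 ℚ), v' ≠ v → 𝓛 (Sum.inr v') = E.kummerLocalConditionAt ((p ^ J : ℕ) : ℤ) (v'.adicCompletion ℚ)) →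
      ∀ (lam : (E.baseChange ℚ_[p]).toAffine.Point →+ ℤ_[p]), (∀ X, lam X = 0 ↔ IsOfFinAddOrder X) → Function.Surjective lam →
      ∀ (P₁ : E.toAffine.Point), (∀ P : E.toAffine.Point, ∃ (a : ℤ) (t : E.toAffine.Point), IsOfFinAddOrder t ∧ P = a • P₁ + t) →
        Nat.card 𝓛.selmerGroup =
          Nat.card ↥(E.selmerGroupPInfty p ⊓ selmerLocalKerPrimaryTorsion E ℚ_[p] p) *
            p ^ (lam (Affine.Point.baseChange (W' := E) ℚ ℚ_[p] P₁)).valuation) :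
∀ (W : WeierstrassCurve ℚ) [W.IsElliptic] [W.IsGloballyMinimal], GoodSS W 2 →
  ∀ (κ : ZpExtension ℚ 2) (γ : Field.absoluteGaloisGroup ℚ), κ.IsCyclotomic → κ.IsTopGenerator γ →
  ∀ (v : HeightOneSpectrum (𝓞 ℚ)), (2 : 𝓞 ℚ) ∈ v.asIdeal →
  ∀ (g : Field.absoluteGaloisGroup (v.adicCompletion ℚ)) (c : ℕ → localPoints W (v.adicCompletion ℚ)),
    κ.IsTopGenerator (resGalOfEmb (closureEmb (K := ℚ) (v.adicCompletion ℚ)) g) →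
    (∀ n, c n ∈ localLayerPointsOfEmb κ (closureEmb (K := ℚ) (v.adicCompletion ℚ)) W n) →
    (∀ n, 1 ≤ n → localTraceOfEmb κ (closureEmb (K := ℚ) (v.adicCompletion ℚ)) W n (n + 1)
      (c (n + 1)) = W.frobeniusTrace 2 • c n - c (n - 1)) →
    (∀ z₀ : localLayerPointsOfEmb κ (closureEmb (K := ℚ) (v.adicCompletion ℚ)) W 0 →+ ℤ_[2],
      evalOn W (localLayerPointsOfEmb κ (closureEmb (K := ℚ) (v.adicCompletion ℚ)) W 0) z₀ (c 0) = 0 → z₀ = 0) →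
    (∀ a : ℤ_[2],
      (∃ z₀ : localLayerPointsOfEmb κ (closureEmb (K := ℚ) (v.adicCompletion ℚ)) W 0 →+ ℤ_[2],
        evalOn W (localLayerPointsOfEmb κ (closureEmb (K := ℚ) (v.adicCompletion ℚ)) W 0) z₀ (c 0) = 2 * a) →
      ∃ y : localLayerPointsOfEmb κ (closureEmb (K := ℚ) (v.adicCompletion ℚ)) W 0 →+ ℤ_[2],
        evalOn W (localLayerPointsOfEmb κ (closureEmb (K := ℚ) (v.adicCompletion ℚ)) W 0) y (c 0) = a) →
    (∃ cneg : localPoints W (v.adicCompletion ℚ),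
      Summit.BirchSwinnertonDyer.Rank1Residual.F1Sign2.IsHondaSystemAtTwo κ (closureEmb (K := ℚ) (v.adicCompletion ℚ)) W
        (W.frobeniusTrace 2) g cneg c) →
  ∀ (W₂ : WeierstrassCurve ℚ) [W₂.IsElliptic] [W₂.IsGloballyMinimal],
    (∃ C : WeierstrassCurve.VariableChange ℚ, C • W.quadraticTwist 2 = W₂) →
    W₂.mordellWeilRank = 1 → Finite (AddCommGroup.primaryComponent W₂.sha 2) →
    Finite (endInvariants (conjSharpFlatSelmerInfty W κ (closureEmb (K := ℚ) (v.adicCompletion ℚ))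
      (W.frobeniusTrace 2) g c .flat γ + 1)) →
  ∃ J₂ : ℕ, ∀ J : ℕ, J₂ ≤ J →
  ∀ (φ : (W₂.torsionGaloisModule ((2 ^ J : ℕ) : ℤ)).toContRepresentation →ⁱL
      (W.twistedTorsionGaloisModule 2 κ J (-1) OddBlindTwist.two_dvd_neg_one_sub_one).toContRepresentation)
    (ψ : (W.twistedTorsionGaloisModule 2 κ J (-1) OddBlindTwist.two_dvd_neg_one_sub_one).toContRepresentation →ⁱL
      (W₂.torsionGaloisModule ((2 ^ J : ℕ) : ℤ)).toContRepresentation),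
    (∀ a, ψ (φ a) = a) → (∀ b, φ (ψ b) = b) →
    (∀ w : InfinitePlace ℚ, ((W.twistedTorsionToLocalH1 2 κ J (-1) OddBlindTwist.two_dvd_neg_one_sub_one w.Completion).ker).map
        (galoisCohomology.map (ψ.restrictField w.Completion) 1) =
      W₂.kummerLocalConditionAt ((2 ^ J : ℕ) : ℤ) w.Completion) →
    (∀ v' : HeightOneSpectrum (𝓞 ℚ), v' ≠ v →
      (W.twistedSharpFlatLocalFamily 2 κ J (-1) OddBlindTwist.two_dvd_neg_one_sub_one v
          (localTowerPointsOfEmb κ (closureEmb (K := ℚ) (v.adicCompletion ℚ)) W)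
          (colemanKer κ (closureEmb (K := ℚ) (v.adicCompletion ℚ)) W (W.frobeniusTrace 2) g c .flat) v').map
        (galoisCohomology.map (ψ.restrictField (v'.adicCompletion ℚ)) 1) =
      ((resH1Hom (Literature.NumberTheory.EllipticCurves.subgroupIncl (localSubgroup κ.kerSubgroup (v'.adicCompletion ℚ)))
          (AddMonoidHom.id (localPoints W₂ (v'.adicCompletion ℚ))) (fun _ _ ↦ rfl)).ker).comap
        (galoisCohomology.map (W₂.torsionPointsMapIntertwining ((2 ^ J : ℕ) : ℤ) (v'.adicCompletion ℚ)) 1)) →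
    (W₂.kummerLocalConditionAt ((2 ^ J : ℕ) : ℤ) (v.adicCompletion ℚ)).map
        (galoisCohomology.map (φ.restrictField (v.adicCompletion ℚ)) 1) ≤
      W.twistedTorsionLocalKummer 2 κ J (-1) OddBlindTwist.two_dvd_neg_one_sub_one (v.adicCompletion ℚ)
        (localLayerPointsOfEmb κ (closureEmb (K := ℚ) (v.adicCompletion ℚ)) W 1 ⊓
          (DistribSMul.toAddMonoidHom (localPoints W (v.adicCompletion ℚ)) g + AddMonoidHom.id _).ker) →
  ∀ (𝓑' : SelmerStructure (W₂.torsionGaloisModule ((2 ^ J : ℕ) : ℤ))),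
    (∀ w : InfinitePlace ℚ, 𝓑' (Sum.inl w) = W₂.kummerLocalConditionAt ((2 ^ J : ℕ) : ℤ) w.Completion) →
    (𝓑' (Sum.inr v) = (W.twistedSharpFlatLocalFamily 2 κ J (-1) OddBlindTwist.two_dvd_neg_one_sub_one v
        (localTowerPointsOfEmb κ (closureEmb (K := ℚ) (v.adicCompletion ℚ)) W)
        (colemanKer κ (closureEmb (K := ℚ) (v.adicCompletion ℚ)) W (W.frobeniusTrace 2) g c .flat) v).map
        (galoisCohomology.map (ψ.restrictField (v.adicCompletion ℚ)) 1)) →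
    (∀ v' : HeightOneSpectrum (𝓞 ℚ), v' ≠ v → 𝓑' (Sum.inr v') = W₂.kummerLocalConditionAt ((2 ^ J : ℕ) : ℤ) (v'.adicCompletion ℚ)) →
  ∀ (lam : (W₂.baseChange ℚ_[2]).toAffine.Point →+ ℤ_[2]), (∀ X, lam X = 0 ↔ IsOfFinAddOrder X) → Function.Surjective lam →
  ∀ (P₁ : W₂.toAffine.Point), (∀ P : W₂.toAffine.Point, ∃ (a : ℤ) (t : W₂.toAffine.Point), IsOfFinAddOrder t ∧ P = a • P₁ + t) →
    Nat.card 𝓑'.selmerGroup =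
      Nat.card ↥(W₂.selmerGroupPInfty 2 ⊓ selmerLocalKerPrimaryTorsion W₂ ℚ_[2] 2) *
        2 ^ (lam (Affine.Point.baseChange (W' := W₂) ℚ ℚ_[2] P₁)).valuation := by
  intro W _ _ hss κ γ hκ hγ v hv g c hg hc htr hz hsat hH W₂ _ _ htw hr hsha hfin
  haveI : Fact (Nat.Prime 2) := ⟨Nat.prime_two⟩
  -- the three «no 2-torsion» inputs for `W₂`
  have h0v := forall_two_nsmul_eq_zero_adicCompletion_twist_of_goodSS W hss W₂ htw v hv
  have h0p := forall_two_nsmul_eq_zero_padic_twist_of_goodSS W hss W₂ htw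
  have h0 : ∀ P : W₂.toAffine.Point, 2 • P = 0 → P = 0 := fun P hP ↦ by
    have hinj := WeierstrassCurve.Affine.Point.map_injective (W' := W₂.toAffine) (f := Algebra.ofId ℚ ℚ_[2])
    apply hinj
    have e1 : Affine.Point.map (W' := W₂.toAffine) (Algebra.ofId ℚ ℚ_[2]) (2 • P) =
        2 • Affine.Point.map (W' := W₂.toAffine) (Algebra.ofId ℚ ℚ_[2]) P := map_nsmul _ _ _
    have e0 : Affine.Point.map (W' := W₂.toAffine) (Algebra.ofId ℚ ℚ_[2]) (2 • P) = 0 :=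
      (congrArg (Affine.Point.map (W' := W₂.toAffine) (Algebra.ofId ℚ ℚ_[2])) hP).trans (map_zero _)
    have e2 : Affine.Point.map (W' := W₂.toAffine) (Algebra.ofId ℚ ℚ_[2]) P = 0 := h0p _ (e1.symm.trans e0)
    exact e2.trans (map_zero _).symm
  have hv' : ((2 : ℕ) : 𝓞 ℚ) ∈ v.asIdeal := by exact_mod_cast hv
  obtain ⟨J₃, hJ₃⟩ := hloc W hss κ hκ v hv g c hg hc htr hz hsat hH W₂ htw
  obtain ⟨J₂, hJ₂⟩ := hglob W₂ 2 v hv' h0v h0p h0 hr hsha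
  refine ⟨max J₂ J₃, fun J hJ φ ψ h₁ h₂ hinf hne hiv 𝓑' hBinf hBv hBv' lam hlam hsurj P₁ hgen ↦ ?_⟩
  obtain ⟨hbot, htop⟩ := hJ₃ J (le_of_max_le_right hJ) φ ψ h₁ h₂ hinf hne hiv
  exact hJ₂ J (le_of_max_le_left hJ) _ hbot htop 𝓑' hBinf hBv hBv' lam hlam hsurj P₁ hgen

/-- ★★ **THE CDC_H GLUE, v2 (four binders: dictionary, Tamagawa count, line complement, line position count)**:
`OddBlindPackage.FlatBlindControlCardHondaAtTwo` (body VERBATIM) from (B1), (B2), (B3loc), (B3glob) — (B3) assembled by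
`position_of_complement_of_lineCount`, (B5) fed by name (`valuation_sub_padicValNat_index_eq_of_generator`, ★ p815278), the rest by
`flatBlindControlCardHondaAtTwo_of` (★★ p814705). HONEST: a reduction; 19097 stays OPEN; BSD is proved for no curve.
[cite: GreenbergLNM1716, §3 Lemma 3.3 and §4 pp. 122–124] [cite: MilneADT2006, I Thm. 4.10] [cite: Sprung2012, Def. 7.9, Def. 7.11, Thm. 2.2] -/
theorem flatBlindControlCardHondaAtTwo_of_dictionary_of_tamagawa_of_complement_of_lineCount
    (hB1 : ∀ (W : WeierstrassCurve ℚ) [W.IsElliptic] [W.IsGloballyMinimal], GoodSS W 2 →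
      ∀ (κ : ZpExtension ℚ 2), κ.IsCyclotomic →
      ∀ (v : HeightOneSpectrum (𝓞 ℚ)), (2 : 𝓞 ℚ) ∈ v.asIdeal →
      ∀ (g : Field.absoluteGaloisGroup (v.adicCompletion ℚ)) (c : ℕ → localPoints W (v.adicCompletion ℚ)),
        κ.IsTopGenerator (resGalOfEmb (closureEmb (K := ℚ) (v.adicCompletion ℚ)) g) →
      ∀ (W₂ : WeierstrassCurve ℚ) [W₂.IsElliptic] [W₂.IsGloballyMinimal],
        (∃ C : WeierstrassCurve.VariableChange ℚ, C • W.quadraticTwist 2 = W₂) →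
      ∀ J : ℕ, ∃ (φ : (W₂.torsionGaloisModule ((2 ^ J : ℕ) : ℤ)).toContRepresentation →ⁱL
          (W.twistedTorsionGaloisModule 2 κ J (-1) OddBlindTwist.two_dvd_neg_one_sub_one).toContRepresentation)
        (ψ : (W.twistedTorsionGaloisModule 2 κ J (-1) OddBlindTwist.two_dvd_neg_one_sub_one).toContRepresentation →ⁱL
          (W₂.torsionGaloisModule ((2 ^ J : ℕ) : ℤ)).toContRepresentation),
        (∀ a, ψ (φ a) = a) ∧ (∀ b, φ (ψ b) = b) ∧
        (∀ w : InfinitePlace ℚ, ((W.twistedTorsionToLocalH1 2 κ J (-1) OddBlindTwist.two_dvd_neg_one_sub_one w.Completion).ker).map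
            (galoisCohomology.map (ψ.restrictField w.Completion) 1) =
          W₂.kummerLocalConditionAt ((2 ^ J : ℕ) : ℤ) w.Completion) ∧
        (∀ v' : HeightOneSpectrum (𝓞 ℚ), v' ≠ v →
          (W.twistedSharpFlatLocalFamily 2 κ J (-1) OddBlindTwist.two_dvd_neg_one_sub_one v
              (localTowerPointsOfEmb κ (closureEmb (K := ℚ) (v.adicCompletion ℚ)) W)
              (colemanKer κ (closureEmb (K := ℚ) (v.adicCompletion ℚ)) W (W.frobeniusTrace 2) g c .flat) v').map
            (galoisCohomology.map (ψ.restrictField (v'.adicCompletion ℚ)) 1) =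
          ((resH1Hom (Literature.NumberTheory.EllipticCurves.subgroupIncl (localSubgroup κ.kerSubgroup (v'.adicCompletion ℚ)))
              (AddMonoidHom.id (localPoints W₂ (v'.adicCompletion ℚ))) (fun _ _ ↦ rfl)).ker).comap
            (galoisCohomology.map (W₂.torsionPointsMapIntertwining ((2 ^ J : ℕ) : ℤ) (v'.adicCompletion ℚ)) 1)) ∧
        (W₂.kummerLocalConditionAt ((2 ^ J : ℕ) : ℤ) (v.adicCompletion ℚ)).map
            (galoisCohomology.map (φ.restrictField (v.adicCompletion ℚ)) 1) ≤
          W.twistedTorsionLocalKummer 2 κ J (-1) OddBlindTwist.two_dvd_neg_one_sub_one (v.adicCompletion ℚ)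
            (localLayerPointsOfEmb κ (closureEmb (K := ℚ) (v.adicCompletion ℚ)) W 1 ⊓
              (DistribSMul.toAddMonoidHom (localPoints W (v.adicCompletion ℚ)) g + AddMonoidHom.id _).ker))
    (hB2 : ∀ (W : WeierstrassCurve ℚ) [W.IsElliptic] [W.IsGloballyMinimal], GoodSS W 2 →
      ∀ (κ : ZpExtension ℚ 2) (γ : Field.absoluteGaloisGroup ℚ), κ.IsCyclotomic → κ.IsTopGenerator γ →
      ∀ (v : HeightOneSpectrum (𝓞 ℚ)), (2 : 𝓞 ℚ) ∈ v.asIdeal →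
      ∀ (g : Field.absoluteGaloisGroup (v.adicCompletion ℚ)) (c : ℕ → localPoints W (v.adicCompletion ℚ)),
        κ.IsTopGenerator (resGalOfEmb (closureEmb (K := ℚ) (v.adicCompletion ℚ)) g) →
      ∀ (W₂ : WeierstrassCurve ℚ) [W₂.IsElliptic] [W₂.IsGloballyMinimal],
        (∃ C : WeierstrassCurve.VariableChange ℚ, C • W.quadraticTwist 2 = W₂) →
        Finite (endInvariants (conjSharpFlatSelmerInfty W κ (closureEmb (K := ℚ) (v.adicCompletion ℚ))
          (W.frobeniusTrace 2) g c .flat γ + 1)) →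
      ∃ J₁ : ℕ, ∀ J : ℕ, J₁ ≤ J →
      ∀ (φ : (W₂.torsionGaloisModule ((2 ^ J : ℕ) : ℤ)).toContRepresentation →ⁱL
          (W.twistedTorsionGaloisModule 2 κ J (-1) OddBlindTwist.two_dvd_neg_one_sub_one).toContRepresentation)
        (ψ : (W.twistedTorsionGaloisModule 2 κ J (-1) OddBlindTwist.two_dvd_neg_one_sub_one).toContRepresentation →ⁱL
          (W₂.torsionGaloisModule ((2 ^ J : ℕ) : ℤ)).toContRepresentation),
        (∀ a, ψ (φ a) = a) → (∀ b, φ (ψ b) = b) →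
        (∀ w : InfinitePlace ℚ, ((W.twistedTorsionToLocalH1 2 κ J (-1) OddBlindTwist.two_dvd_neg_one_sub_one w.Completion).ker).map
            (galoisCohomology.map (ψ.restrictField w.Completion) 1) =
          W₂.kummerLocalConditionAt ((2 ^ J : ℕ) : ℤ) w.Completion) →
        (∀ v' : HeightOneSpectrum (𝓞 ℚ), v' ≠ v →
          (W.twistedSharpFlatLocalFamily 2 κ J (-1) OddBlindTwist.two_dvd_neg_one_sub_one v
              (localTowerPointsOfEmb κ (closureEmb (K := ℚ) (v.adicCompletion ℚ)) W)
              (colemanKer κ (closureEmb (K := ℚ) (v.adicCompletion ℚ)) W (W.frobeniusTrace 2) g c .flat) v').map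
            (galoisCohomology.map (ψ.restrictField (v'.adicCompletion ℚ)) 1) =
          ((resH1Hom (Literature.NumberTheory.EllipticCurves.subgroupIncl (localSubgroup κ.kerSubgroup (v'.adicCompletion ℚ)))
              (AddMonoidHom.id (localPoints W₂ (v'.adicCompletion ℚ))) (fun _ _ ↦ rfl)).ker).comap
            (galoisCohomology.map (W₂.torsionPointsMapIntertwining ((2 ^ J : ℕ) : ℤ) (v'.adicCompletion ℚ)) 1)) →
        (W₂.kummerLocalConditionAt ((2 ^ J : ℕ) : ℤ) (v.adicCompletion ℚ)).map
            (galoisCohomology.map (φ.restrictField (v.adicCompletion ℚ)) 1) ≤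
          W.twistedTorsionLocalKummer 2 κ J (-1) OddBlindTwist.two_dvd_neg_one_sub_one (v.adicCompletion ℚ)
            (localLayerPointsOfEmb κ (closureEmb (K := ℚ) (v.adicCompletion ℚ)) W 1 ⊓
              (DistribSMul.toAddMonoidHom (localPoints W (v.adicCompletion ℚ)) g + AddMonoidHom.id _).ker) →
      ∀ (𝓑 𝓑' : SelmerStructure (W₂.torsionGaloisModule ((2 ^ J : ℕ) : ℤ))),
        (∀ w : InfinitePlace ℚ, 𝓑 (Sum.inl w) =
          ((W.twistedTorsionToLocalH1 2 κ J (-1) OddBlindTwist.two_dvd_neg_one_sub_one w.Completion).ker).map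
            (galoisCohomology.map (ψ.restrictField w.Completion) 1)) →
        (∀ v' : HeightOneSpectrum (𝓞 ℚ), 𝓑 (Sum.inr v') =
          (W.twistedSharpFlatLocalFamily 2 κ J (-1) OddBlindTwist.two_dvd_neg_one_sub_one v
            (localTowerPointsOfEmb κ (closureEmb (K := ℚ) (v.adicCompletion ℚ)) W)
            (colemanKer κ (closureEmb (K := ℚ) (v.adicCompletion ℚ)) W (W.frobeniusTrace 2) g c .flat) v').map
            (galoisCohomology.map (ψ.restrictField (v'.adicCompletion ℚ)) 1)) →
        (∀ w : InfinitePlace ℚ, 𝓑' (Sum.inl w) = W₂.kummerLocalConditionAt ((2 ^ J : ℕ) : ℤ) w.Completion) →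
        (𝓑' (Sum.inr v) = (W.twistedSharpFlatLocalFamily 2 κ J (-1) OddBlindTwist.two_dvd_neg_one_sub_one v
            (localTowerPointsOfEmb κ (closureEmb (K := ℚ) (v.adicCompletion ℚ)) W)
            (colemanKer κ (closureEmb (K := ℚ) (v.adicCompletion ℚ)) W (W.frobeniusTrace 2) g c .flat) v).map
            (galoisCohomology.map (ψ.restrictField (v.adicCompletion ℚ)) 1)) →
        (∀ v' : HeightOneSpectrum (𝓞 ℚ), v' ≠ v → 𝓑' (Sum.inr v') = W₂.kummerLocalConditionAt ((2 ^ J : ℕ) : ℤ) (v'.adicCompletion ℚ)) →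
        Nat.card 𝓑.selmerGroup *
            2 ^ padicValNat 2 ((W₂.baseChange (v.adicCompletion ℚ)).localTamagawaNumber (v.adicCompletionIntegers ℚ)) =
          Nat.card 𝓑'.selmerGroup * 2 ^ padicValNat 2 W₂.tamagawaProduct)
    (hloc : ∀ (W : WeierstrassCurve ℚ) [W.IsElliptic] [W.IsGloballyMinimal], GoodSS W 2 →
      ∀ (κ : ZpExtension ℚ 2), κ.IsCyclotomic →
      ∀ (v : HeightOneSpectrum (𝓞 ℚ)), (2 : 𝓞 ℚ) ∈ v.asIdeal →
      ∀ (g : Field.absoluteGaloisGroup (v.adicCompletion ℚ)) (c : ℕ → localPoints W (v.adicCompletion ℚ)),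
        κ.IsTopGenerator (resGalOfEmb (closureEmb (K := ℚ) (v.adicCompletion ℚ)) g) →
        (∀ n, c n ∈ localLayerPointsOfEmb κ (closureEmb (K := ℚ) (v.adicCompletion ℚ)) W n) →
        (∀ n, 1 ≤ n → localTraceOfEmb κ (closureEmb (K := ℚ) (v.adicCompletion ℚ)) W n (n + 1)
          (c (n + 1)) = W.frobeniusTrace 2 • c n - c (n - 1)) →
        (∀ z₀ : localLayerPointsOfEmb κ (closureEmb (K := ℚ) (v.adicCompletion ℚ)) W 0 →+ ℤ_[2],
          evalOn W (localLayerPointsOfEmb κ (closureEmb (K := ℚ) (v.adicCompletion ℚ)) W 0) z₀ (c 0) = 0 → z₀ = 0) →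
        (∀ a : ℤ_[2],
          (∃ z₀ : localLayerPointsOfEmb κ (closureEmb (K := ℚ) (v.adicCompletion ℚ)) W 0 →+ ℤ_[2],
            evalOn W (localLayerPointsOfEmb κ (closureEmb (K := ℚ) (v.adicCompletion ℚ)) W 0) z₀ (c 0) = 2 * a) →
          ∃ y : localLayerPointsOfEmb κ (closureEmb (K := ℚ) (v.adicCompletion ℚ)) W 0 →+ ℤ_[2],
            evalOn W (localLayerPointsOfEmb κ (closureEmb (K := ℚ) (v.adicCompletion ℚ)) W 0) y (c 0) = a) →
        (∃ cneg : localPoints W (v.adicCompletion ℚ),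
          Summit.BirchSwinnertonDyer.Rank1Residual.F1Sign2.IsHondaSystemAtTwo κ (closureEmb (K := ℚ) (v.adicCompletion ℚ)) W
            (W.frobeniusTrace 2) g cneg c) →
      ∀ (W₂ : WeierstrassCurve ℚ) [W₂.IsElliptic] [W₂.IsGloballyMinimal],
        (∃ C : WeierstrassCurve.VariableChange ℚ, C • W.quadraticTwist 2 = W₂) →
      ∃ J₃ : ℕ, ∀ J : ℕ, J₃ ≤ J →
      ∀ (φ : (W₂.torsionGaloisModule ((2 ^ J : ℕ) : ℤ)).toContRepresentation →ⁱL
          (W.twistedTorsionGaloisModule 2 κ J (-1) OddBlindTwist.two_dvd_neg_one_sub_one).toContRepresentation)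
        (ψ : (W.twistedTorsionGaloisModule 2 κ J (-1) OddBlindTwist.two_dvd_neg_one_sub_one).toContRepresentation →ⁱL
          (W₂.torsionGaloisModule ((2 ^ J : ℕ) : ℤ)).toContRepresentation),
        (∀ a, ψ (φ a) = a) → (∀ b, φ (ψ b) = b) →
        (∀ w : InfinitePlace ℚ, ((W.twistedTorsionToLocalH1 2 κ J (-1) OddBlindTwist.two_dvd_neg_one_sub_one w.Completion).ker).map
            (galoisCohomology.map (ψ.restrictField w.Completion) 1) =
          W₂.kummerLocalConditionAt ((2 ^ J : ℕ) : ℤ) w.Completion) →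
        (∀ v' : HeightOneSpectrum (𝓞 ℚ), v' ≠ v →
          (W.twistedSharpFlatLocalFamily 2 κ J (-1) OddBlindTwist.two_dvd_neg_one_sub_one v
              (localTowerPointsOfEmb κ (closureEmb (K := ℚ) (v.adicCompletion ℚ)) W)
              (colemanKer κ (closureEmb (K := ℚ) (v.adicCompletion ℚ)) W (W.frobeniusTrace 2) g c .flat) v').map
            (galoisCohomology.map (ψ.restrictField (v'.adicCompletion ℚ)) 1) =
          ((resH1Hom (Literature.NumberTheory.EllipticCurves.subgroupIncl (localSubgroup κ.kerSubgroup (v'.adicCompletion ℚ)))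
              (AddMonoidHom.id (localPoints W₂ (v'.adicCompletion ℚ))) (fun _ _ ↦ rfl)).ker).comap
            (galoisCohomology.map (W₂.torsionPointsMapIntertwining ((2 ^ J : ℕ) : ℤ) (v'.adicCompletion ℚ)) 1)) →
        (W₂.kummerLocalConditionAt ((2 ^ J : ℕ) : ℤ) (v.adicCompletion ℚ)).map
            (galoisCohomology.map (φ.restrictField (v.adicCompletion ℚ)) 1) ≤
          W.twistedTorsionLocalKummer 2 κ J (-1) OddBlindTwist.two_dvd_neg_one_sub_one (v.adicCompletion ℚ)
            (localLayerPointsOfEmb κ (closureEmb (K := ℚ) (v.adicCompletion ℚ)) W 1 ⊓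
              (DistribSMul.toAddMonoidHom (localPoints W (v.adicCompletion ℚ)) g + AddMonoidHom.id _).ker) →
        (W.twistedSharpFlatLocalFamily 2 κ J (-1) OddBlindTwist.two_dvd_neg_one_sub_one v
            (localTowerPointsOfEmb κ (closureEmb (K := ℚ) (v.adicCompletion ℚ)) W)
            (colemanKer κ (closureEmb (K := ℚ) (v.adicCompletion ℚ)) W (W.frobeniusTrace 2) g c .flat) v).map
          (galoisCohomology.map (ψ.restrictField (v.adicCompletion ℚ)) 1) ⊓
          W₂.kummerLocalConditionAt ((2 ^ J : ℕ) : ℤ) (v.adicCompletion ℚ) = ⊥ ∧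
        (W.twistedSharpFlatLocalFamily 2 κ J (-1) OddBlindTwist.two_dvd_neg_one_sub_one v
            (localTowerPointsOfEmb κ (closureEmb (K := ℚ) (v.adicCompletion ℚ)) W)
            (colemanKer κ (closureEmb (K := ℚ) (v.adicCompletion ℚ)) W (W.frobeniusTrace 2) g c .flat) v).map
          (galoisCohomology.map (ψ.restrictField (v.adicCompletion ℚ)) 1) ⊔
          W₂.kummerLocalConditionAt ((2 ^ J : ℕ) : ℤ) (v.adicCompletion ℚ) = ⊤)
    (hglob : ∀ (E : WeierstrassCurve ℚ) [E.IsElliptic] (p : ℕ) [Fact p.Prime]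
      (v : HeightOneSpectrum (𝓞 ℚ)), ((p : ℕ) : 𝓞 ℚ) ∈ v.asIdeal →
      (∀ P : (E.baseChange (v.adicCompletion ℚ)).toAffine.Point, p • P = 0 → P = 0) →
      (∀ P : (E.baseChange ℚ_[p]).toAffine.Point, p • P = 0 → P = 0) →
      (∀ P : E.toAffine.Point, p • P = 0 → P = 0) →
      E.mordellWeilRank = 1 → Finite (AddCommGroup.primaryComponent E.sha p) →
      ∃ J₂ : ℕ, ∀ J : ℕ, J₂ ≤ J →
      ∀ (L : AddSubgroup (galoisCohomology ((E.torsionGaloisModule ((p ^ J : ℕ) : ℤ)).restrictField (v.adicCompletion ℚ)) 1)),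
        L ⊓ E.kummerLocalConditionAt ((p ^ J : ℕ) : ℤ) (v.adicCompletion ℚ) = ⊥ →
        L ⊔ E.kummerLocalConditionAt ((p ^ J : ℕ) : ℤ) (v.adicCompletion ℚ) = ⊤ →
      ∀ (𝓛 : SelmerStructure (E.torsionGaloisModule ((p ^ J : ℕ) : ℤ))),
        (∀ w : InfinitePlace ℚ, 𝓛 (Sum.inl w) = E.kummerLocalConditionAt ((p ^ J : ℕ) : ℤ) w.Completion) →
        𝓛 (Sum.inr v) = L →
        (∀ v' : HeightOneSpectrum (𝓞 ℚ), v' ≠ v → 𝓛 (Sum.inr v') = E.kummerLocalConditionAt ((p ^ J : ℕ) : ℤ) (v'.adicCompletion ℚ)) →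
      ∀ (lam : (E.baseChange ℚ_[p]).toAffine.Point →+ ℤ_[p]), (∀ X, lam X = 0 ↔ IsOfFinAddOrder X) → Function.Surjective lam →
      ∀ (P₁ : E.toAffine.Point), (∀ P : E.toAffine.Point, ∃ (a : ℤ) (t : E.toAffine.Point), IsOfFinAddOrder t ∧ P = a • P₁ + t) →
        Nat.card 𝓛.selmerGroup =
          Nat.card ↥(E.selmerGroupPInfty p ⊓ selmerLocalKerPrimaryTorsion E ℚ_[p] p) *
            p ^ (lam (Affine.Point.baseChange (W' := E) ℚ ℚ_[p] P₁)).valuation) :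
    ∀ (W : WeierstrassCurve ℚ) [W.IsElliptic] [W.IsGloballyMinimal],
    ¬ W.HasCM → GoodSS W 2 → W.rootNumber * ZMod.χ₈ (W.conductorNorm ℤ : ZMod 8) = -1 →
    ∀ (κ : ZpExtension ℚ 2) (γ : Field.absoluteGaloisGroup ℚ),
      κ.IsCyclotomic → κ.IsTopGenerator γ → IsCyclotomicVariable 2 γ →
    ∀ (v : HeightOneSpectrum (𝓞 ℚ)), (2 : 𝓞 ℚ) ∈ v.asIdeal →
    ∀ (g : Field.absoluteGaloisGroup (v.adicCompletion ℚ)) (c : ℕ → localPoints W (v.adicCompletion ℚ)),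
      κ.IsTopGenerator (resGalOfEmb (closureEmb (K := ℚ) (v.adicCompletion ℚ)) g) →
      (∀ n, c n ∈ localLayerPointsOfEmb κ (closureEmb (K := ℚ) (v.adicCompletion ℚ)) W n) →
      (∀ n, 1 ≤ n → localTraceOfEmb κ (closureEmb (K := ℚ) (v.adicCompletion ℚ)) W n (n + 1)
        (c (n + 1)) = W.frobeniusTrace 2 • c n - c (n - 1)) →
      (∀ z₀ : localLayerPointsOfEmb κ (closureEmb (K := ℚ) (v.adicCompletion ℚ)) W 0 →+ ℤ_[2],
        evalOn W (localLayerPointsOfEmb κ (closureEmb (K := ℚ) (v.adicCompletion ℚ)) W 0) z₀ (c 0) = 0 →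
          z₀ = 0) →
      (∀ a : ℤ_[2],
        (∃ z₀ : localLayerPointsOfEmb κ (closureEmb (K := ℚ) (v.adicCompletion ℚ)) W 0 →+ ℤ_[2],
          evalOn W (localLayerPointsOfEmb κ (closureEmb (K := ℚ) (v.adicCompletion ℚ)) W 0) z₀ (c 0) = 2 * a) →
        ∃ y : localLayerPointsOfEmb κ (closureEmb (K := ℚ) (v.adicCompletion ℚ)) W 0 →+ ℤ_[2],
          evalOn W (localLayerPointsOfEmb κ (closureEmb (K := ℚ) (v.adicCompletion ℚ)) W 0) y (c 0) = a) →
      (∃ cneg : localPoints W (v.adicCompletion ℚ),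
        Summit.BirchSwinnertonDyer.Rank1Residual.F1Sign2.IsHondaSystemAtTwo κ (closureEmb (K := ℚ) (v.adicCompletion ℚ)) W
          (W.frobeniusTrace 2) g cneg c) →
    ∀ (W₂ : WeierstrassCurve ℚ) [W₂.IsElliptic] [W₂.IsGloballyMinimal],
      (∃ C : WeierstrassCurve.VariableChange ℚ, C • W.quadraticTwist 2 = W₂) →
      W₂.mordellWeilRank = 1 → Finite (AddCommGroup.primaryComponent W₂.sha 2) →
    ∀ (ι : ℚ →+* ℚ_[2]) (P : (W₂.baseChange ℚ).toAffine.Point), ¬ IsOfFinAddOrder P →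
      Finite (endInvariants (conjSharpFlatSelmerInfty W κ (closureEmb (K := ℚ) (v.adicCompletion ℚ))
        (W.frobeniusTrace 2) g c .flat γ + 1)) →
      (padicValNat 2 (Nat.card (endInvariants (conjSharpFlatSelmerInfty W κ
          (closureEmb (K := ℚ) (v.adicCompletion ℚ)) (W.frobeniusTrace 2) g c .flat γ + 1))) : ℤ) =
        (padicValNat 2 (Nat.card (AddCommGroup.primaryComponent W₂.sha 2)) : ℤ) +
          (padicValNat 2 W₂.tamagawaProduct : ℤ) +
          2 * (Literature.NumberTheory.EllipticCurves.padicLogOrd W₂ 2 ι P -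
            (padicValNat 2 (AddSubgroup.zmultiples P).index : ℤ)) :=
  flatBlindControlCardHondaAtTwo_of hB1 hB2 (position_of_complement_of_lineCount hloc hglob)
    valuation_sub_padicValNat_index_eq_of_generator

end OddBlindLocal

end Summit.BirchSwinnertonDyer.BirchSwinnertonDyer.Theorems
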